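import Summits.CriticalPhenomena.PercolationContinuityZ3.Theorems.PercNearOneGluingNoHeavyLowerTailCSHPsiUnfoldMain
import Summits.CriticalPhenomena.PercolationContinuityZ3.Theorems.PercNearOneGluingNoHeavyLowerTailCSHPsiHpart
import Summits.CriticalPhenomena.PercolationContinuityZ3.Theorems.PercNearOneGluingNoHeavyLowerTailCSHPsiRefinedConj4
import HarnessLib

/-!
# Pinned hierarchy (PIN-CSH) — THEOREM 1_ψ (`PinCSH.Holds` for all data), and the event-refined pre-FKG inequalities UNCONDITIONALLY

Support file (`--supports stmt-CriticalPhenomena-4575`), route task `nh-dp-fatminority` (line fat-minority-linear, gen 16); memo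
`run/shared/lean/prim/prim-nh-dp-fatminority/CSH-PSI-MEMO.md` Theorem 1_ψ (§1–§2) and §3–§4 (consequences).  No definitions, no named facts, no
sorries; standard axioms.  The assembly of the pinned bricks landed by this seat — Lemma T_ψ (`PinCSH.pMargin_nonneg_of_within`,
`…CSHPsiLemmaT`), Lemma U_ψ (`PinCSH.within_nonneg_of_hpart_pin`, `…CSHPsiUnfoldMain`), Lemma H_ψ (`PinCSH.hpart_nonneg_pin`, `…CSHPsiHpart`,
from (K6)_ψ `PinCSH.setFourPT_pin` of gen 15 and (Htw)_ψ via the general-`θ` two-source induction `CovTau.p1G_univ`, `…CSHPsiWorld`) — by the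
UNIFORM strong induction on the number of decoys of prim-png-lead-4576's second proof of Theorem 1 (`CSH.cshMargin_nonneg_of_lower_induction`,
`…AdditiveGluingCSHNilFromHpart.lean`): no separate base case, level zero is Lemma T_ψ(`[]`) ∘ Lemma U_ψ(`[]`) ∘ Lemma H_ψ(`{x}`).

* `PinCSH.pMargin_nonneg_of_lower_induction`, `PinCSH.holds` — **THEOREM 1_ψ**: `PinCSH.Holds w o 𝓗 x Y D v` for non-degenerate weights, an
  upper family `𝓗`, `v ∉ {x} ∪ Y`, `v ≠ o`, and distinct decoys off `{x} ∪ Y ∪ {o, v}`;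
* `PinCSH.holds_schema` — the same in the literal hypothesis shape `hPin` of the conditional consumers of gen 15;
* UNCONDITIONAL consequences (gen 15's consumers with `hPin` discharged): `PinCSH.preMargin_nonneg` (the refined pre-FKG margin at every decoy
  level, memo §3), `PinCSH.refined_margin_nonneg` (the event-refined Conjecture-4 margin `0 ≤ ∫_{E ∩ {o↔A}} (F(C_o) − F(C_c))`, memo §4),
  `PinCSH.conj4_refined` (Kozma–Nitzan's Conjecture 4 refined by ANY increasing cluster event of the observer, every relay set),
  `PinCSH.question7_refined` (Question 7 / (41) refined: `μ(c↔b, E, o↔A) ≤ μ(o↔b, E, o↔A)` — the line's UT4 and QUT4(`δ ≤ 0`) for EVERY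
  number of ports, and QS), `PinCSH.conj4_refinedVertex` (vertex-cluster events).
[cite: KozmaNitzan2024, Conj. 4 (p. 32), Question 7 (p. 36), (41) (p. 33)] [cite: VandenbergHaggstromKahn2005, Thm. 1.3 (p. 6), Thm. 1.4 (p. 7), §2.1 (pp. 9–13)]
[cite: Gladkov2024, Thm. 3.2 (p. 4)]
-/

noncomputable section

namespace Summit.CriticalPhenomena.PercolationContinuityZ3.Theorems

open MeasureTheory Set Literature.Probability.LatticeModels Literature.Probability.Percolation
open scoped Classical

namespace PinCSH

variable {V : Type*} [Fintype V]

/-! ### Theorem 1_ψ -/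

/-- **THEOREM 1_ψ by the UNIFORM strong induction on the number of decoys** (memo Theorem 1_ψ; the pinned twin of
`CSH.cshMargin_nonneg_of_lower_induction`): for non-degenerate weights, an upper family `𝓗`, `v ∉ {x} ∪ Y`, `v ≠ o`, and distinct decoys off
`{x} ∪ Y ∪ {o, v}`, `0 ≤ PinCSH.pMargin w o 𝓗 x Y D v f` for every decoy list `D` and every monotone `f`.  The step, from all strictly shorter
lists to `D`: Lemma T_ψ reduces to the world-wise pinned margin; Lemma U_ψ splits it into the pinned H-part at the marker set `{x} ∪ D` —
nonnegative by Lemma H_ψ — plus the lower-level PINNED margins along the splittings `D = pre ++ d :: ds'` (owner `d`, avoided set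
`{x} ∪ Y ∪ pre`, decoys `ds'`, same label `o`, same test: the induction hypothesis).
(transcription of the memo prim-nh-dp-fatminority CSH-PSI-MEMO.md §2, proof of Theorem 1_ψ)
[cite: VandenbergHaggstromKahn2005, §2.1 (pp. 9–13), Thm. 1.4 (p. 7)] [cite: KozmaNitzan2024, Question 7 (p. 36)] -/
theorem pMargin_nonneg_of_lower_induction (w : Sym2 V → unitInterval) (hw : ∀ e, 0 < w e ∧ w e < 1) (o : V)
    (𝓗 : Set (Set (Sym2 V))) (h𝓗 : IsUpperSet 𝓗) :
    ∀ (D : List V) (x : V) (Y : Set V) (v : V),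
      v ∉ insert x Y → v ≠ o → D.Nodup → (∀ d ∈ D, d ∉ insert x Y ∧ d ≠ o ∧ d ≠ v) →
      ∀ f : Set (Sym2 V) → ℝ, Monotone f → 0 ≤ pMargin w o 𝓗 x Y D v f := by
  have hY : ∀ (Y : Set V) (e : Sym2 V), ¬ e.IsDiag → (∃ u ∈ e, u ∈ Y) → (w e : ℝ) < 1 :=
    fun _ e _ _ => unitInterval.coe_lt_one.2 (hw e).2
  -- THE UNIFORM STEP: from all strictly shorter decoy lists (any owner / avoided set, same label and observer) to `D`
  have step : ∀ (D : List V) (x : V) (Y : Set V) (v : V),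
      v ∉ insert x Y → v ≠ o → D.Nodup → (∀ d ∈ D, d ∉ insert x Y ∧ d ≠ o ∧ d ≠ v) →
      (∀ (D' : List V) (x' : V) (Y' : Set V), D'.length < D.length → v ∉ insert x' Y' → D'.Nodup →
        (∀ d ∈ D', d ∉ insert x' Y' ∧ d ≠ o ∧ d ≠ v) → ∀ h : Set (Sym2 V) → ℝ, Monotone h → 0 ≤ pMargin w o 𝓗 x' Y' D' v h) →
      ∀ f : Set (Sym2 V) → ℝ, Monotone f → 0 ≤ pMargin w o 𝓗 x Y D v f := by
    intro D x Y v hv hvo hnd hdis ih f hf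
    -- Lemma T_ψ: reduce to the world-wise margin
    refine pMargin_nonneg_of_within w o 𝓗 x Y D v (hY Y) (fun g hg hg0 => ?_) f hf
    -- Lemma U_ψ: H-part + lower levels
    have hD' : ∀ d ∈ D, d ≠ x ∧ d ∉ Y ∧ d ≠ o ∧ d ≠ v := fun d hd => by
      obtain ⟨h1, h2, h3⟩ := hdis d hd
      rw [mem_insert_iff, not_or] at h1
      exact ⟨h1.1, h1.2, h2, h3⟩
    refine within_nonneg_of_hpart_pin w hw o 𝓗 x Y D v hvo hnd hD' hg (fun pre d ds' hsplit h hh _ => ?_) ?_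
    · -- the lower level `(d | {x} ∪ Y ∪ pre ; ds')` has fewer decoys: induction hypothesis
      have hlen : ds'.length < D.length := by
        have : D.length = pre.length + (ds'.length + 1) := by rw [hsplit, List.length_append, List.length_cons]
        omega
      have hdD : d ∈ D := by rw [hsplit]; exact List.mem_append_right pre List.mem_cons_self
      have hpreD : ∀ e ∈ pre, e ∈ D := fun e he => by rw [hsplit]; exact List.mem_append_left _ he
      have hds'D : ∀ e ∈ ds', e ∈ D := fun e he => by
        rw [hsplit]; exact List.mem_append_right pre (List.mem_cons_of_mem d he)
      -- nodup bookkeeping along `pre ++ d :: ds'`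
      have hnd' : (pre ++ d :: ds').Nodup := hsplit ▸ hnd
      have hnd_ds' : ds'.Nodup := (List.nodup_cons.1 (List.nodup_append.1 hnd').2.1).2
      have hd_notin_ds' : d ∉ ds' := (List.nodup_cons.1 (List.nodup_append.1 hnd').2.1).1
      have hds'_notin_pre : ∀ e ∈ ds', e ∉ pre := fun e he hep =>
        (List.nodup_append.1 hnd').2.2 e hep e (List.mem_cons_of_mem d he) rfl
      -- the new avoided set
      set Y' : Set V := insert x Y ∪ {e | e ∈ pre} with hY'
      have hvY' : v ∉ insert d Y' := by
        rintro (h0 | h1 | h2)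
        · exact (hdis d hdD).2.2 h0.symm
        · exact hv h1
        · exact (hdis v (hpreD v h2)).2.2 rfl
      have hdis' : ∀ e ∈ ds', e ∉ insert d Y' ∧ e ≠ o ∧ e ≠ v := by
        intro e he
        refine ⟨?_, (hdis e (hds'D e he)).2.1, (hdis e (hds'D e he)).2.2⟩
        rintro (h0 | h1 | h2)
        · exact hd_notin_ds' (h0 ▸ he)
        · exact (hdis e (hds'D e he)).1 h1
        · exact hds'_notin_pre e he h2
      exact ih ds' d Y' hlen hvY' hnd_ds' hdis' h hh
    · -- Lemma H_ψ at the marker set `{x} ∪ D`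
      have hv' : v ≠ x ∧ v ∉ Y := by rwa [mem_insert_iff, not_or] at hv
      have hvS : v ∉ insert x D.toFinset := by
        rw [Finset.mem_insert, List.mem_toFinset, not_or]
        exact ⟨hv'.1, fun h => (hdis v h).2.2 rfl⟩
      have hS : ((↑(insert x D.toFinset) : Set V) ∪ Y) = insert x Y ∪ {d | d ∈ D} := by
        ext u
        simp only [Finset.coe_insert, mem_union, mem_insert_iff, Finset.mem_coe, List.mem_toFinset, mem_setOf_eq]
        tauto
      have key := hpart_nonneg_pin w hw x Y (insert x D.toFinset) (Finset.mem_insert_self x _) o 𝓗 h𝓗 v hvS hv'.2 g hg hg0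
      rw [hS] at key
      -- the two statements agree up to the (subsingleton) decidability instances inside the world weights
      convert key using 20
  -- strong induction on the length of the decoy list
  suffices hk : ∀ (k : ℕ) (D : List V), D.length ≤ k → ∀ (x : V) (Y : Set V) (v : V),
      v ∉ insert x Y → v ≠ o → D.Nodup → (∀ d ∈ D, d ∉ insert x Y ∧ d ≠ o ∧ d ≠ v) →
      ∀ f : Set (Sym2 V) → ℝ, Monotone f → 0 ≤ pMargin w o 𝓗 x Y D v f from
    fun D => hk D.length D le_rfl
  intro k
  induction k with
  | zero =>
    intro D hD x Y v hv hvo hnd hdis f hf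
    exact step D x Y v hv hvo hnd hdis (fun D' _ _ hlt => absurd (lt_of_lt_of_le hlt hD) (Nat.not_lt_zero _)) f hf
  | succ k ih =>
    intro D hD x Y v hv hvo hnd hdis f hf
    exact step D x Y v hv hvo hnd hdis
      (fun D' x' Y' hlt hv' hnd' hdis' h hh => ih D' (by omega) x' Y' v hv' hvo hnd' hdis' h hh) f hf

/-- **THEOREM 1_ψ — the pinned conditioned slack hierarchy holds** (`PinCSH.Holds`, memo Theorem 1_ψ): for non-degenerate weights, an upper
family `𝓗` of edge sets, an owner `x`, an avoided set `Y`, an observer `v ∉ {x} ∪ Y` with `v ≠ o`, and a nodup decoy list avoiding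
`x, Y, o, v`, the pinned margin is nonnegative for every monotone functional of the open edge cluster of the owner.
(transcription of the memo prim-nh-dp-fatminority CSH-PSI-MEMO.md Theorem 1_ψ) [cite: VandenbergHaggstromKahn2005, §2.1 (pp. 9–13)]
[cite: KozmaNitzan2024, Question 7 (p. 36)] -/
theorem holds (w : Sym2 V → unitInterval) (hw : ∀ e, 0 < w e ∧ w e < 1) (o : V) (𝓗 : Set (Set (Sym2 V))) (h𝓗 : IsUpperSet 𝓗)
    (x : V) (Y : Set V) (D : List V) (v : V) (hv : v ∉ insert x Y) (hvo : v ≠ o) (hnd : D.Nodup)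
    (hdis : ∀ d ∈ D, d ∉ insert x Y ∧ d ≠ o ∧ d ≠ v) : Holds w o 𝓗 x Y D v :=
  fun f hf => pMargin_nonneg_of_lower_induction w hw o 𝓗 h𝓗 D x Y v hv hvo hnd hdis f hf

/-- **Theorem 1_ψ in the literal hypothesis shape `hPin`** of the conditional consumers `PinCSH.refined_margin_nonneg_of_pin` /
`conj4_refined_of_pin` / `question7_refined_of_pin` / `conj4_refinedVertex_of_pin` (gen 15). [cite: KozmaNitzan2024, Question 7 (p. 36)] -/
theorem holds_schema {n : ℕ} (w : Sym2 (Fin n) → unitInterval) (hw : ∀ e, 0 < w e ∧ w e < 1) (o : Fin n)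
    (𝓗 : Set (Set (Sym2 (Fin n)))) (h𝓗 : IsUpperSet 𝓗) :
    ∀ (v x : Fin n) (Y : Finset (Fin n)) (D : List (Fin n)),
      o ≠ v → x ∉ Y → o ≠ x → v ≠ x → o ∉ Y → v ∉ Y → D.Nodup → (∀ d ∈ D, d ≠ x ∧ d ∉ Y ∧ d ≠ o ∧ d ≠ v) →
      Holds w o 𝓗 x (↑Y : Set (Fin n)) D v := by
  intro v x Y D hov _ _ hvx _ hvY hD hdis
  refine holds w hw o 𝓗 h𝓗 x (↑Y : Set (Fin n)) D v ?_ (Ne.symm hov) hD ?_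
  · simp only [mem_insert_iff, Finset.mem_coe, not_or]; exact ⟨hvx, hvY⟩
  · intro d hd
    obtain ⟨h1, h2, h3, h4⟩ := hdis d hd
    exact ⟨by simp only [mem_insert_iff, Finset.mem_coe, not_or]; exact ⟨h1, h2⟩, h3, h4⟩

/-! ### The event-refined pre-FKG inequalities, unconditionally -/

variable {n : ℕ}

/-- **The refined pre-FKG margin at every decoy level, UNCONDITIONALLY** (memo §3, `(pS5D)_ψ`): for `X ∌ o, v` (`o ≠ v`), `c ∈ X` of least
mean, every decoy list `D` and every monotone `F`, `0 ≤ Marg_{X,D}[u ↦ Δ_u(X) (u ≠ o), o ↦ Δ^E_o(X)]` with the pinned constants.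
[cite: KozmaNitzan2024, Conj. 4 (p. 32)] [cite: VandenbergHaggstromKahn2005, §2.1 Lemma 2.4 (p. 10)] -/
theorem preMargin_nonneg (w : Sym2 (Fin n) → unitInterval) (hw : ∀ e, 0 < w e ∧ w e < 1) (o v : Fin n) (hov : o ≠ v)
    (𝓗 : Set (Set (Sym2 (Fin n)))) (h𝓗 : IsUpperSet 𝓗) :
    ∀ (X : Finset (Fin n)) (c : Fin n) (D : List (Fin n)) (F : Set (Fin n) → ℝ),
      (∀ S S' : Set (Fin n), S ⊆ S' → F S ≤ F S') → c ∈ X →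
      (∀ a ∈ X, ∫ ω, F (openCluster ω c) ∂(prodBernoulli w) ≤ ∫ ω, F (openCluster ω a) ∂(prodBernoulli w)) →
      o ∉ X → v ∉ X → D.Nodup → (∀ d ∈ D, d ∉ X ∧ d ≠ o ∧ d ≠ v) →
      0 ≤ CSH.cshMarg (pDecoyList w o 𝓗 (↑X : Set (Fin n)) D) (pObsConst w o 𝓗 v ((↑X : Set (Fin n)) ∪ {d | d ∈ D})) o v
        (fun u => if u = o then
            ∫ ω in {ω : BondConfig (Fin n) | openEdgeCluster ω o ∈ 𝓗} ∩ ⋃ a ∈ X, openConn o a,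
              (F (openCluster ω o) - F (openCluster ω c)) ∂(prodBernoulli w)
          else ∫ ω in ⋃ a ∈ X, openConn u a, (F (openCluster ω u) - F (openCluster ω c)) ∂(prodBernoulli w)) :=
  preMargin_nonneg_of_pin w hw o v 𝓗 (fun x Y D h1 h2 h3 h4 h5 h6 h7 => holds_schema w hw o 𝓗 h𝓗 v x Y D hov h1 h2 h3 h4 h5 h6 h7)

/-- **THE EVENT-REFINED CONJECTURE-4 MARGIN, UNCONDITIONALLY** (memo §4; the line fat-minority-linear's (41)_E / Conj 4_E): for non-degenerate
weights, `o ∉ A`, `c ∈ A` of least mean, every monotone `F` and every increasing event `E = {C_o ∈ 𝓗}` of the open edge cluster of the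
observer, `0 ≤ ∫_{E ∩ {o ↔ A}} (F(C_o) − F(C_c)) dμ`. [cite: KozmaNitzan2024, Conj. 4 (p. 32)] [cite: VandenbergHaggstromKahn2005, Thm. 1.3 (p. 6)] -/
theorem refined_margin_nonneg (w : Sym2 (Fin n) → unitInterval) (hw : ∀ e, 0 < w e ∧ w e < 1) (o : Fin n)
    (𝓗 : Set (Set (Sym2 (Fin n)))) (h𝓗 : IsUpperSet 𝓗)
    (F : Set (Fin n) → ℝ) (hF : ∀ S T : Set (Fin n), S ⊆ T → F S ≤ F T)
    (A : Finset (Fin n)) (c : Fin n) (hoA : o ∉ A) (hcA : c ∈ A)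
    (hcmin : ∀ a ∈ A, ∫ ω, F (openCluster ω c) ∂(prodBernoulli w) ≤ ∫ ω, F (openCluster ω a) ∂(prodBernoulli w)) :
    0 ≤ ∫ ω in {ω : BondConfig (Fin n) | openEdgeCluster ω o ∈ 𝓗} ∩ ⋃ a' ∈ A, openConn o a',
        (F (openCluster ω o) - F (openCluster ω c)) ∂(prodBernoulli w) :=
  refined_margin_nonneg_of_pin w hw o 𝓗 h𝓗 (holds_schema w hw o 𝓗 h𝓗) F hF A c hoA hcA hcmin

/-- **KOZMA–NITZAN'S CONJECTURE 4 REFINED BY ANY INCREASING CLUSTER EVENT OF THE OBSERVER, UNCONDITIONALLY** (designated form): for `A ≠ ∅`,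
`o`, `E = {C_o ∈ 𝓗}` (`𝓗` upper) and monotone `F`, some `a ∈ A` has `∫_{E ∩ {o↔A}} F(C_a) ≤ ∫_{E ∩ {o↔A}} F(C_o)`.
[cite: KozmaNitzan2024, Conj. 4 (p. 32)] -/
theorem conj4_refined (w : Sym2 (Fin n) → unitInterval) (hw : ∀ e, 0 < w e ∧ w e < 1) (o : Fin n)
    (𝓗 : Set (Set (Sym2 (Fin n)))) (h𝓗 : IsUpperSet 𝓗)
    (F : Set (Fin n) → ℝ) (hF : ∀ S T : Set (Fin n), S ⊆ T → F S ≤ F T) (A : Finset (Fin n)) (hA : A.Nonempty) :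
    ∃ a ∈ A, ∫ ω in {ω : BondConfig (Fin n) | openEdgeCluster ω o ∈ 𝓗} ∩ ⋃ a' ∈ A, openConn o a',
        F (openCluster ω a) ∂(prodBernoulli w) ≤
      ∫ ω in {ω : BondConfig (Fin n) | openEdgeCluster ω o ∈ 𝓗} ∩ ⋃ a' ∈ A, openConn o a',
        F (openCluster ω o) ∂(prodBernoulli w) :=
  conj4_refined_of_pin w hw o 𝓗 h𝓗 (holds_schema w hw o 𝓗 h𝓗) F hF A hA

/-- **QUESTION 7 / (41) REFINED BY ANY INCREASING CLUSTER EVENT OF THE OBSERVER, UNCONDITIONALLY** — the fat-minority line's UT4 and QUT4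
(`δ ≤ 0`) for EVERY number of ports (`o` a star centre, `𝓗` a pattern up-set of its edges), QS (spectator edges), and the general-observer form:
for `E = {C_o ∈ 𝓗}`, `o ∉ A`, and `c ∈ A` with `μ(c ↔ b) ≤ μ(a ↔ b)` for all `a ∈ A`,
`μ({c ↔ b} ∩ E ∩ {o ↔ A}) ≤ μ({o ↔ b} ∩ E ∩ {o ↔ A})`. [cite: KozmaNitzan2024, Question 7 (p. 36), (41) (p. 33)] -/
theorem question7_refined (w : Sym2 (Fin n) → unitInterval) (hw : ∀ e, 0 < w e ∧ w e < 1) (o : Fin n)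
    (𝓗 : Set (Set (Sym2 (Fin n)))) (h𝓗 : IsUpperSet 𝓗)
    (b : Fin n) (A : Finset (Fin n)) (c : Fin n) (hoA : o ∉ A) (hcA : c ∈ A)
    (hcmin : ∀ a ∈ A, (prodBernoulli w).real (openConn c b) ≤ (prodBernoulli w).real (openConn a b)) :
    (prodBernoulli w).real
        (openConn c b ∩ ({ω : BondConfig (Fin n) | openEdgeCluster ω o ∈ 𝓗} ∩ ⋃ a ∈ A, openConn o a)) ≤
      (prodBernoulli w).real
        (openConn o b ∩ ({ω : BondConfig (Fin n) | openEdgeCluster ω o ∈ 𝓗} ∩ ⋃ a ∈ A, openConn o a)) :=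
  question7_refined_of_pin w hw o 𝓗 h𝓗 (holds_schema w hw o 𝓗 h𝓗) b A c hoA hcA hcmin

/-- **Conjecture 4 refined by an increasing event of the observer's VERTEX cluster, UNCONDITIONALLY** (`E = {C(o) ∈ 𝓥}` for an upper family
`𝓥` of vertex sets — the general-observer events of the line). [cite: KozmaNitzan2024, Conj. 4 (p. 32)] -/
theorem conj4_refinedVertex (w : Sym2 (Fin n) → unitInterval) (hw : ∀ e, 0 < w e ∧ w e < 1) (o : Fin n)
    (𝓥 : Set (Set (Fin n))) (h𝓥 : IsUpperSet 𝓥)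
    (F : Set (Fin n) → ℝ) (hF : ∀ S T : Set (Fin n), S ⊆ T → F S ≤ F T) (A : Finset (Fin n)) (hA : A.Nonempty) :
    ∃ a ∈ A, ∫ ω in {ω : BondConfig (Fin n) | openCluster ω o ∈ 𝓥} ∩ ⋃ a' ∈ A, openConn o a',
        F (openCluster ω a) ∂(prodBernoulli w) ≤
      ∫ ω in {ω : BondConfig (Fin n) | openCluster ω o ∈ 𝓥} ∩ ⋃ a' ∈ A, openConn o a',
        F (openCluster ω o) ∂(prodBernoulli w) := by
  have h𝓗 : IsUpperSet {K : Set (Sym2 (Fin n)) | {z : Fin n | z = o ∨ ∃ e ∈ K, z ∈ e} ∈ 𝓥} := by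
    intro K K' hKK' hK
    refine h𝓥 ?_ hK
    intro z hz
    rcases hz with h | ⟨e, he, hze⟩
    · exact Or.inl h
    · exact Or.inr ⟨e, hKK' he, hze⟩
  exact conj4_refinedVertex_of_pin w hw o 𝓥 h𝓥 (holds_schema w hw o _ h𝓗) F hF A hA

end PinCSH

end Summit.CriticalPhenomena.PercolationContinuityZ3.Theorems

end
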